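import Literature.Probability.Percolation.BlockConditioning
import HarnessLib

/-!
# Garban's (B.4) in averaged form: `E[X C] ≥ 2ρ (P[good ∩ docked] + P[good ∩ dual-docked] - P[good])`

Topic `Literature/Probability/Percolation`; proof-only support file for the named fact
`Literature.Probability.Percolation.Garban2011_fourArm_multiscale` (`FourArmGarban.lean`;
C. Garban, Appendix B of O. Schramm, S. Smirnov, Ann. Probab. 39 (2011), Lemma B.1). No
definition, no named fact.

`BlockConditioning.lean` proves Garban's (B.4) `E[X C_j] ≳ P[good]` under a POINTWISE docking
hypothesis: for every good configuration outside the block, the two conditional docking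
probabilities add up to at least `1 + c₀` (`le_integral_mul_bit_of_good`, hypothesis `hdock`).
Garban's own wording is an averaged one — "`P[X = 1 | C_j = 1 and Q_j pivotal for X] > 1/2 + 1/8`",
a probability conditioned on the EVENT "`Q_j` pivotal", not on the outside configuration — and it
is the averaged form that arm-separation arguments deliver (a given outside configuration may well
make docking impossible). This file proves the averaged statement, with exactly the data of
`le_integral_mul_bit_of_good` minus `hdock`:

* `blockDockingSum B F ω = Σ_{ξ ⊆ B} P_p(obs B = ξ) 1_{F ω ξ}` — the conditional docking
  probability given the outside, as a finite sum; it equals `P_p{ζ | F ω (obs ζ B)}`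
  (`blockDockingSum_eq_real`), is measurable in `ω` (`measurable_blockDockingSum`) when the
  docking predicate only reads the outside of `ω` (`hFdet`), and integrates over a good outside
  event to `P_p(good ∩ {F · (obs · B)})` (`integral_indicator_mul_blockDockingSum`);
* `le_integral_mul_bit_of_good_avg` — **`2 P_p(O) · (P_p(good ∩ docked) + P_p(good ∩ dual-docked)
  - P_p(good)) ≤ E_p[X C]`**: on each good outside configuration the conditional covariance is at
  least `2ρ (P(F) + P(F*) - 1)` (`le_sum_powerset_mul_bit_of_dockings`), elsewhere it is `≥ 0`
  (`integral_outside_mul_mul_bit_nonneg`), and the pointwise bound is integrated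
  (`integral_outside_mul_eq`).

## References

* O. Schramm, S. Smirnov (appendix by C. Garban), Ann. Probab. 39 (2011), Appendix B, proof of
  Lemma B.1, (B.4)–(B.5) and the two displays before (B.6) [SchrammSmirnov2011].
* G. Grimmett, *Percolation*, 2nd ed. (1999), §2.2 Thm 2.4 (Harris–FKG) [GrimmettPercolation1999].

Tree: `obs`, `obs_subset`, `obs_sdiff_union`, `sdiff_union_obs`, `measurable_sdiff_union`,
`measurableSet_setOf_comp_obs`, `integral_comp_obs_eq_sum`, `integral_outside_mul_eq`,
`integral_outside_mul_mul_bit_nonneg`, `le_sum_powerset_mul_bit_of_dockings`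
(`BlockConditioning.lean`), `measurable_comp_obs`, `abs_comp_obs_le`
(`RevealmentOrthogonality.lean`).
-/

noncomputable section

namespace Literature.Probability.Percolation

open _root_.MeasureTheory _root_.ProbabilityTheory ProbeHistory
open scoped ENNReal Classical

variable {V : Type*} [Countable V] (G : SimpleGraph V) (p : unitInterval)

/-! ### The conditional docking probability as a function of the outside -/

/-- **The conditional docking probability given the outside**, as a finite sum over the inside
configurations: `Σ_{ξ ⊆ B} P_p(obs B = ξ) 1_{F ω ξ}`. [cite: SchrammSmirnov2011, Appendix B, proof of Lemma B.1 (the conditional law inside Q_j)] -/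
def blockDockingSum (B : Finset (Sym2 V)) (F : BondConfig V → Finset (Sym2 V) → Prop)
    (ω : BondConfig V) : ℝ :=
  ∑ ξ ∈ B.powerset, (bondPercolation G p).real {ζ | obs ζ B = ξ} * (if F ω ξ then (1 : ℝ) else 0)

/-- The docking sum is the conditional docking probability `P_p{ζ | F ω (obs ζ B)}`. [folklore] -/
theorem blockDockingSum_eq_real (B : Finset (Sym2 V)) (F : BondConfig V → Finset (Sym2 V) → Prop)
    (ω : BondConfig V) :
    blockDockingSum G p B F ω = (bondPercolation G p).real {ζ | F ω (obs ζ B)} := by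
  rw [blockDockingSum, ← integral_comp_obs_eq_sum G p B fun ξ => if F ω ξ then (1 : ℝ) else 0,
    ← integral_indicator_one (measurableSet_setOf_comp_obs B (F ω))]
  refine integral_congr_ae (ae_of_all _ fun ζ => ?_)
  simp only [Set.indicator_apply, Set.mem_setOf_eq, Pi.one_apply]

/-- `0 ≤` docking sum `≤ 1`. [folklore] -/
theorem blockDockingSum_mem_Icc (B : Finset (Sym2 V)) (F : BondConfig V → Finset (Sym2 V) → Prop)
    (ω : BondConfig V) : blockDockingSum G p B F ω ∈ Set.Icc (0 : ℝ) 1 := by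
  rw [blockDockingSum_eq_real]
  exact ⟨measureReal_nonneg, measureReal_le_one⟩

omit [Countable V] in
/-- If the docking predicate reads `ω` only off the block, the slice `{ω | F ω ξ}` is measurable
as soon as the diagonal event `{ω | F ω (obs ω B)}` is. [folklore] -/
theorem measurableSet_setOf_dock (B : Finset (Sym2 V)) {F : BondConfig V → Finset (Sym2 V) → Prop}
    (hFdet : ∀ ω, ∀ ξ' ⊆ B, ∀ ξ, F (ω \ ↑B ∪ ↑ξ') ξ ↔ F ω ξ)
    (hFm : MeasurableSet {ω | F ω (obs ω B)}) {ξ : Finset (Sym2 V)} (hξ : ξ ⊆ B) :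
    MeasurableSet {ω | F ω ξ} := by
  have hset : {ω | F ω ξ} = (fun ω : BondConfig V => ω \ ↑B ∪ ↑ξ) ⁻¹' {ω | F ω (obs ω B)} := by
    ext ω
    simp only [Set.mem_setOf_eq, Set.mem_preimage]
    rw [obs_sdiff_union hξ, hFdet ω ξ hξ ξ]
  rw [hset]
  exact measurable_sdiff_union B _ hFm

omit [Countable V] in
/-- The docking sum is measurable in the outside configuration. [folklore] -/
theorem measurable_blockDockingSum (B : Finset (Sym2 V)) {F : BondConfig V → Finset (Sym2 V) → Prop}
    (hFdet : ∀ ω, ∀ ξ' ⊆ B, ∀ ξ, F (ω \ ↑B ∪ ↑ξ') ξ ↔ F ω ξ)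
    (hFm : MeasurableSet {ω | F ω (obs ω B)}) :
    Measurable (blockDockingSum G p B F) := by
  refine Finset.measurable_sum _ fun ξ hξ => Measurable.const_mul ?_ _
  have hm := measurableSet_setOf_dock B hFdet hFm (Finset.mem_powerset.1 hξ)
  have : (fun ω : BondConfig V => if F ω ξ then (1 : ℝ) else 0) =
      {ω | F ω ξ}.indicator (1 : BondConfig V → ℝ) := by
    funext ω
    simp only [Set.indicator_apply, Set.mem_setOf_eq, Pi.one_apply]
  rw [this]
  exact measurable_one.indicator hm

omit [Countable V] in
/-- The docking sum does not depend on the inside configuration. [folklore] -/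
theorem blockDockingSum_sdiff_union (B : Finset (Sym2 V)) {F : BondConfig V → Finset (Sym2 V) → Prop}
    (hFdet : ∀ ω, ∀ ξ' ⊆ B, ∀ ξ, F (ω \ ↑B ∪ ↑ξ') ξ ↔ F ω ξ) (ω : BondConfig V) {ξ' : Finset (Sym2 V)}
    (hξ' : ξ' ⊆ B) : blockDockingSum G p B F (ω \ ↑B ∪ ↑ξ') = blockDockingSum G p B F ω := by
  unfold blockDockingSum
  refine Finset.sum_congr rfl fun ξ _ => ?_
  rw [hFdet ω ξ' hξ' ξ]

/-- **Integrating the conditional docking probability over a good outside event** gives the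
probability of the joint event: `∫ 1_{good} · P_p(F | outside) dP_p = P_p(good ∩ {docked})`.
[cite: SchrammSmirnov2011, Appendix B, proof of Lemma B.1 ((B.5): conditioning on Q_j pivotal)] -/
theorem integral_indicator_mul_blockDockingSum (B : Finset (Sym2 V)) (Good : Set (BondConfig V))
    (hGm : MeasurableSet Good) (hGdet : ∀ ω, ∀ ξ ⊆ B, (ω \ ↑B ∪ ↑ξ ∈ Good ↔ ω ∈ Good))
    {F : BondConfig V → Finset (Sym2 V) → Prop}
    (hFdet : ∀ ω, ∀ ξ' ⊆ B, ∀ ξ, F (ω \ ↑B ∪ ↑ξ') ξ ↔ F ω ξ)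
    (hFm : MeasurableSet {ω | F ω (obs ω B)}) :
    ∫ ω, Good.indicator (1 : BondConfig V → ℝ) ω * blockDockingSum G p B F ω ∂(bondPercolation G p) =
      (bondPercolation G p).real (Good ∩ {ω | F ω (obs ω B)}) := by
  set μ := bondPercolation G p with hμ
  -- the right-hand side as `∫ 1_{Good} · 1_{F ω (obs ω B)}`
  set Find : BondConfig V → ℝ := {ω | F ω (obs ω B)}.indicator (1 : BondConfig V → ℝ) with hFind
  have hFind_m : Measurable Find := measurable_one.indicator hFm
  have hFind_b : ∀ ω, |Find ω| ≤ 1 := fun ω => by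
    simp only [hFind, Set.indicator_apply, Pi.one_apply]
    split_ifs <;> simp
  have hind1 : ∀ ω, |Good.indicator (1 : BondConfig V → ℝ) ω| ≤ 1 := fun ω => by
    simp only [Set.indicator_apply, Pi.one_apply]; split_ifs <;> simp
  have hrhs : μ.real (Good ∩ {ω | F ω (obs ω B)}) =
      ∫ ω, Good.indicator (1 : BondConfig V → ℝ) ω * Find ω ∂μ := by
    rw [← integral_indicator_one (hGm.inter hFm)]
    refine integral_congr_ae (ae_of_all _ fun ω => ?_)
    simp only [hFind, Set.indicator_apply, Set.mem_inter_iff, Set.mem_setOf_eq, Pi.one_apply]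
    by_cases h1 : ω ∈ Good <;> by_cases h2 : F ω (obs ω B) <;> simp [h1, h2]
  rw [hrhs, integral_outside_mul_eq G p B (a := Good.indicator (1 : BondConfig V → ℝ))
    (measurable_one.indicator hGm) hind1
    (fun ω ξ hξ => by simp only [Set.indicator_apply, hGdet ω ξ hξ, Pi.one_apply]) hFind_m hFind_b]
  refine integral_congr_ae (ae_of_all _ fun ω => ?_)
  dsimp only
  congr 1
  unfold blockDockingSum
  refine Finset.sum_congr rfl fun ξ hξ => ?_
  have hξB : ξ ⊆ B := Finset.mem_powerset.1 hξ
  congr 1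
  simp only [hFind, Set.indicator_apply, Set.mem_setOf_eq, Pi.one_apply]
  rw [obs_sdiff_union hξB, hFdet ω ξ hξB ξ]

/-! ### Garban's (B.4), averaged over the good outside event -/

/-- **Garban's (B.4), averaged form** (SS11 App. B, proof of Lemma B.1, (B.4)–(B.5) and the two
displays before (B.6): "`P[X = 1 | C_j = 1 and Q_j pivotal for X] > 1/2 + 1/8` [...] the opposite
bound for the term conditioned on `{C_j = -1}` [...] `E[X C_j | Q_j pivotal for X] > ρ/2`"). Let
`X` be measurable, increasing, `|X| ≤ 1`; `B` a finite block of edges with bit `C = 1_O - 1_D`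
(`O` increasing, `D` decreasing block events of the same probability); `Good` a measurable event
determined off `B`; and `F_ω` (increasing inside), `F*_ω` (decreasing inside) docking predicates
reading `ω` only off `B`, such that on `Good`, `F_ω ∩ O` forces `X = 1` and `F*_ω ∩ D` forces
`X = -1`. Then

  `2 P_p(O) · (P_p(Good ∩ {F}) + P_p(Good ∩ {F*}) - P_p(Good)) ≤ E_p[X C]`,

where `{F} = {ω | F_ω (obs ω B)}` is the event "docked" read on the actual configuration. No
lower bound on the conditional docking probabilities is assumed: off `Good` the conditional
covariance is `≥ 0` (Harris inside the block), on `Good` it is at least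
`2ρ (P_p(F_ω) + P_p(F*_ω) - 1)` pointwise (`le_sum_powerset_mul_bit_of_dockings`), and the
conditional docking probabilities integrate to the joint probabilities
(`integral_indicator_mul_blockDockingSum`). [cite: SchrammSmirnov2011, Appendix B, proof of Lemma B.1, (B.4)-(B.5)] -/
theorem le_integral_mul_bit_of_good_avg (B : Finset (Sym2 V)) {X : BondConfig V → ℝ}
    (hXm : Measurable X) (hX1 : ∀ ω, |X ω| ≤ 1) (hXmono : Monotone X)
    (O D : Finset (Sym2 V) → Prop)
    (hO : ∀ ξ ξ' : Finset (Sym2 V), ξ ⊆ ξ' → ξ' ⊆ B → O ξ → O ξ')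
    (hD : ∀ ξ ξ' : Finset (Sym2 V), ξ ⊆ ξ' → ξ' ⊆ B → D ξ' → D ξ)
    (hOD : (bondPercolation G p).real {ζ | O (obs ζ B)} = (bondPercolation G p).real {ζ | D (obs ζ B)})
    (F Fs : BondConfig V → Finset (Sym2 V) → Prop)
    (hF : ∀ ω, ∀ ξ ξ' : Finset (Sym2 V), ξ ⊆ ξ' → ξ' ⊆ B → F ω ξ → F ω ξ')
    (hFs : ∀ ω, ∀ ξ ξ' : Finset (Sym2 V), ξ ⊆ ξ' → ξ' ⊆ B → Fs ω ξ' → Fs ω ξ)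
    (hFdet : ∀ ω, ∀ ξ' ⊆ B, ∀ ξ, F (ω \ ↑B ∪ ↑ξ') ξ ↔ F ω ξ)
    (hFsdet : ∀ ω, ∀ ξ' ⊆ B, ∀ ξ, Fs (ω \ ↑B ∪ ↑ξ') ξ ↔ Fs ω ξ)
    (hFm : MeasurableSet {ω | F ω (obs ω B)}) (hFsm : MeasurableSet {ω | Fs ω (obs ω B)})
    (Good : Set (BondConfig V)) (hGm : MeasurableSet Good)
    (hGdet : ∀ ω, ∀ ξ ⊆ B, (ω \ ↑B ∪ ↑ξ ∈ Good ↔ ω ∈ Good))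
    (hFO : ∀ ω ∈ Good, ∀ ξ ⊆ B, F ω ξ → O ξ → X (ω \ ↑B ∪ ↑ξ) = 1)
    (hFD : ∀ ω ∈ Good, ∀ ξ ⊆ B, Fs ω ξ → D ξ → X (ω \ ↑B ∪ ↑ξ) = -1) :
    2 * (bondPercolation G p).real {ζ | O (obs ζ B)} *
        ((bondPercolation G p).real (Good ∩ {ω | F ω (obs ω B)}) +
          (bondPercolation G p).real (Good ∩ {ω | Fs ω (obs ω B)}) -
          (bondPercolation G p).real Good) ≤
      ∫ ω, X ω * ((if O (obs ω B) then (1 : ℝ) else 0) - (if D (obs ω B) then (1 : ℝ) else 0))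
        ∂(bondPercolation G p) := by
  set μ := bondPercolation G p with hμ
  set ρ : ℝ := μ.real {ζ | O (obs ζ B)} with hρ
  set φ : Finset (Sym2 V) → ℝ := fun ξ => (if O ξ then (1 : ℝ) else 0) - (if D ξ then (1 : ℝ) else 0)
    with hφ
  -- the bit is increasing and has mean zero
  have hφmono : ∀ ξ ξ' : Finset (Sym2 V), ξ ⊆ ξ' → ξ' ⊆ B → φ ξ ≤ φ ξ' := by
    intro ξ ξ' hξ hξ'
    have h1 : (if O ξ then (1 : ℝ) else 0) ≤ (if O ξ' then (1 : ℝ) else 0) := by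
      by_cases ho : O ξ
      · rw [if_pos ho, if_pos (hO ξ ξ' hξ hξ' ho)]
      · rw [if_neg ho]; split_ifs <;> norm_num
    have h2 : (if D ξ' then (1 : ℝ) else 0) ≤ (if D ξ then (1 : ℝ) else 0) := by
      by_cases hd : D ξ'
      · rw [if_pos hd, if_pos (hD ξ ξ' hξ hξ' hd)]
      · rw [if_neg hd]; split_ifs <;> norm_num
    simp only [hφ]
    linarith
  have hIO : Integrable ({ζ : BondConfig V | O (obs ζ B)}.indicator (1 : BondConfig V → ℝ)) μ :=
    (integrable_const (1 : ℝ)).indicator (measurableSet_setOf_comp_obs B O)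
  have hID : Integrable ({ζ : BondConfig V | D (obs ζ B)}.indicator (1 : BondConfig V → ℝ)) μ :=
    (integrable_const (1 : ℝ)).indicator (measurableSet_setOf_comp_obs B D)
  have hφ0 : ∫ ζ, φ (obs ζ B) ∂μ = 0 := by
    have h1 : ∫ ζ, φ (obs ζ B) ∂μ =
        ∫ ζ, ({ζ | O (obs ζ B)}.indicator (1 : BondConfig V → ℝ) ζ -
          {ζ | D (obs ζ B)}.indicator (1 : BondConfig V → ℝ) ζ) ∂μ := by
      refine integral_congr_ae (ae_of_all _ fun ζ => ?_)
      simp only [hφ, Set.indicator_apply, Set.mem_setOf_eq, Pi.one_apply]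
    rw [h1, integral_sub (f := {ζ : BondConfig V | O (obs ζ B)}.indicator (1 : BondConfig V → ℝ))
        (g := {ζ : BondConfig V | D (obs ζ B)}.indicator (1 : BondConfig V → ℝ)) hIO hID,
      integral_indicator_one (measurableSet_setOf_comp_obs B O),
      integral_indicator_one (measurableSet_setOf_comp_obs B D), ← hOD, hρ, sub_self]
  -- integrability of `X C` and the split `1 = 1_{Good} + 1_{Goodᶜ}`
  have hXi : Integrable (fun ω => X ω * φ (obs ω B)) μ := by
    refine Integrable.of_bound (hXm.mul (measurable_comp_obs B φ)).aestronglyMeasurable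
      (1 * ∑ o ∈ B.powerset, |φ o|) (ae_of_all _ fun ω => ?_)
    rw [Real.norm_eq_abs, abs_mul]
    exact mul_le_mul (hX1 ω) (abs_comp_obs_le B φ ω) (abs_nonneg _) zero_le_one
  have hind1 : ∀ (S : Set (BondConfig V)) (ω : BondConfig V),
      |S.indicator (1 : BondConfig V → ℝ) ω| ≤ 1 :=
    fun S ω => by simp only [Set.indicator_apply, Pi.one_apply]; split_ifs <;> simp
  have hind0 : ∀ (S : Set (BondConfig V)) (ω : BondConfig V),
      0 ≤ S.indicator (1 : BondConfig V → ℝ) ω :=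
    fun S ω => by simp only [Set.indicator_apply, Pi.one_apply]; split_ifs <;> simp
  have hsplit : ∫ ω, X ω * φ (obs ω B) ∂μ =
      ∫ ω, Good.indicator (1 : BondConfig V → ℝ) ω * (X ω * φ (obs ω B)) ∂μ +
        ∫ ω, Goodᶜ.indicator (1 : BondConfig V → ℝ) ω * (X ω * φ (obs ω B)) ∂μ := by
    have hA : Integrable (fun ω => Good.indicator (1 : BondConfig V → ℝ) ω * (X ω * φ (obs ω B))) μ :=
      (hXi.indicator hGm).congr (ae_of_all _ fun ω => by
        simp only [Set.indicator_apply, Pi.one_apply]; split_ifs <;> simp)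
    have hB' : Integrable (fun ω => Goodᶜ.indicator (1 : BondConfig V → ℝ) ω * (X ω * φ (obs ω B))) μ :=
      (hXi.indicator hGm.compl).congr (ae_of_all _ fun ω => by
        simp only [Set.indicator_apply, Pi.one_apply]; split_ifs <;> simp)
    rw [← integral_add hA hB']
    refine integral_congr_ae (ae_of_all _ fun ω => ?_)
    show X ω * φ (obs ω B) = Good.indicator (1 : BondConfig V → ℝ) ω * (X ω * φ (obs ω B)) +
      Goodᶜ.indicator (1 : BondConfig V → ℝ) ω * (X ω * φ (obs ω B))
    by_cases h : ω ∈ Good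
    · rw [Set.indicator_of_mem h, Set.indicator_of_notMem (show ω ∉ Goodᶜ from fun h' => h' h)]
      simp
    · rw [Set.indicator_of_notMem h, Set.indicator_of_mem (show ω ∈ Goodᶜ from h)]
      simp
  rw [hsplit]
  -- off `Good`: nonnegative (Harris inside the block)
  have hbad : 0 ≤ ∫ ω, Goodᶜ.indicator (1 : BondConfig V → ℝ) ω * (X ω * φ (obs ω B)) ∂μ := by
    have h := integral_outside_mul_mul_bit_nonneg G p B (a := Goodᶜ.indicator (1 : BondConfig V → ℝ))
      (measurable_one.indicator hGm.compl) (hind1 Goodᶜ) (hind0 Goodᶜ)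
      (fun ω ξ hξ => by
        simp only [Set.indicator_apply, Set.mem_compl_iff, hGdet ω ξ hξ, Pi.one_apply])
      (f := fun ω => -X ω) hXm.neg (K := 1) (fun ω => by rw [abs_neg]; exact hX1 ω)
      (fun ω ξ ξ' hξ _ => neg_le_neg (hXmono (Set.union_subset_union_right _
        (Finset.coe_subset.2 hξ))))
      (fun ξ => -φ ξ) (fun ξ ξ' hξ hξ' => neg_le_neg (hφmono ξ ξ' hξ hξ'))
      (by rw [integral_neg, hφ0, neg_zero])
    refine h.trans_eq (integral_congr_ae (ae_of_all _ fun ω => ?_))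
    simp only
    ring
  -- on `Good`: the integrated docking bound
  set d : BondConfig V → ℝ := blockDockingSum G p B F with hd
  set ds : BondConfig V → ℝ := blockDockingSum G p B Fs with hds
  have hdm : Measurable d := measurable_blockDockingSum G p B hFdet hFm
  have hdsm : Measurable ds := measurable_blockDockingSum G p B hFsdet hFsm
  have hd1 : ∀ ω, |d ω| ≤ 1 := fun ω => by
    have h := blockDockingSum_mem_Icc G p B F ω
    rw [abs_le]; exact ⟨by linarith [h.1], h.2⟩
  have hds1 : ∀ ω, |ds ω| ≤ 1 := fun ω => by
    have h := blockDockingSum_mem_Icc G p B Fs ω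
    rw [abs_le]; exact ⟨by linarith [h.1], h.2⟩
  have hgood : 2 * ρ * (μ.real (Good ∩ {ω | F ω (obs ω B)}) + μ.real (Good ∩ {ω | Fs ω (obs ω B)}) -
      μ.real Good) ≤ ∫ ω, Good.indicator (1 : BondConfig V → ℝ) ω * (X ω * φ (obs ω B)) ∂μ := by
    -- the three integrals on the left
    have hI1 := integral_indicator_mul_blockDockingSum G p B Good hGm hGdet hFdet hFm
    have hI2 := integral_indicator_mul_blockDockingSum G p B Good hGm hGdet hFsdet hFsm
    have hI3 : ∫ ω, Good.indicator (1 : BondConfig V → ℝ) ω ∂μ = μ.real Good := integral_indicator_one hGm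
    have hlin : 2 * ρ * (μ.real (Good ∩ {ω | F ω (obs ω B)}) + μ.real (Good ∩ {ω | Fs ω (obs ω B)}) -
        μ.real Good) = ∫ ω, Good.indicator (1 : BondConfig V → ℝ) ω * (2 * ρ * (d ω + ds ω - 1)) ∂μ := by
      have hi1 : Integrable (fun ω => Good.indicator (1 : BondConfig V → ℝ) ω * d ω) μ :=
        Integrable.of_bound ((measurable_one.indicator hGm).mul hdm).aestronglyMeasurable 1
          (ae_of_all _ fun ω => by
            rw [Real.norm_eq_abs, abs_mul]
            exact mul_le_one₀ (hind1 Good ω) (abs_nonneg _) (hd1 ω))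
      have hi2 : Integrable (fun ω => Good.indicator (1 : BondConfig V → ℝ) ω * ds ω) μ :=
        Integrable.of_bound ((measurable_one.indicator hGm).mul hdsm).aestronglyMeasurable 1
          (ae_of_all _ fun ω => by
            rw [Real.norm_eq_abs, abs_mul]
            exact mul_le_one₀ (hind1 Good ω) (abs_nonneg _) (hds1 ω))
      have hi3 : Integrable (Good.indicator (1 : BondConfig V → ℝ)) μ :=
        (integrable_const (1 : ℝ)).indicator hGm
      have heq : ∀ ω, Good.indicator (1 : BondConfig V → ℝ) ω * (2 * ρ * (d ω + ds ω - 1)) =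
          2 * ρ * (Good.indicator (1 : BondConfig V → ℝ) ω * d ω +
            Good.indicator (1 : BondConfig V → ℝ) ω * ds ω - Good.indicator (1 : BondConfig V → ℝ) ω) :=
        fun ω => by ring
      rw [integral_congr_ae (ae_of_all _ heq), integral_const_mul,
        integral_sub (f := fun ω => Good.indicator (1 : BondConfig V → ℝ) ω * d ω +
          Good.indicator (1 : BondConfig V → ℝ) ω * ds ω) (g := Good.indicator (1 : BondConfig V → ℝ))
          (hi1.add hi2) hi3,
        integral_add hi1 hi2]
      rw [← hμ] at hI1 hI2
      rw [hd, hds, hI1, hI2, hI3]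
    rw [hlin]
    -- `E[1_{Good} X C] = ∫ 1_{Good}(ω) S(ω)` with `S` the conditional covariance
    have hXφK : ∀ ω, |X ω * φ (obs ω B)| ≤ |(1 : ℝ)| * ∑ o ∈ B.powerset, |φ o| := fun ω => by
      rw [abs_mul]
      exact mul_le_mul (by rw [abs_one]; exact hX1 ω) (abs_comp_obs_le B φ ω) (abs_nonneg _)
        (abs_nonneg _)
    rw [integral_outside_mul_eq G p B (a := Good.indicator (1 : BondConfig V → ℝ))
      (measurable_one.indicator hGm) (hind1 Good)
      (fun ω ξ hξ => by simp only [Set.indicator_apply, hGdet ω ξ hξ, Pi.one_apply])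
      (F := fun ω => X ω * φ (obs ω B)) (hXm.mul (measurable_comp_obs B φ)) hXφK]
    -- integrability of both sides
    set S : BondConfig V → ℝ := fun ω => ∑ ξ ∈ B.powerset,
      μ.real {ζ | obs ζ B = ξ} * (X (ω \ ↑B ∪ ↑ξ) * φ (obs (ω \ ↑B ∪ ↑ξ) B)) with hS
    have hSm : Measurable S := Finset.measurable_sum _ fun ξ _ =>
      (((hXm.mul (measurable_comp_obs B φ)).comp (measurable_sdiff_union B _))).const_mul _
    have hSK : ∀ ω, |S ω| ≤ ∑ ξ ∈ B.powerset, 1 * (|(1 : ℝ)| * ∑ o ∈ B.powerset, |φ o|) := fun ω => by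
      refine (Finset.abs_sum_le_sum_abs _ _).trans (Finset.sum_le_sum fun ξ _ => ?_)
      rw [abs_mul]
      exact mul_le_mul (by rw [abs_of_nonneg measureReal_nonneg]; exact measureReal_le_one)
        (hXφK _) (abs_nonneg _) zero_le_one
    have hrhs_i : Integrable (fun ω => Good.indicator (1 : BondConfig V → ℝ) ω * S ω) μ :=
      Integrable.of_bound ((measurable_one.indicator hGm).mul hSm).aestronglyMeasurable
        (1 * ∑ ξ ∈ B.powerset, 1 * (|(1 : ℝ)| * ∑ o ∈ B.powerset, |φ o|)) (ae_of_all _ fun ω => by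
          rw [Real.norm_eq_abs, abs_mul]
          exact mul_le_mul (hind1 Good ω) (hSK ω) (abs_nonneg _) zero_le_one)
    have hlhs_m : Measurable fun ω => Good.indicator (1 : BondConfig V → ℝ) ω * (2 * ρ * (d ω + ds ω - 1)) :=
      (measurable_one.indicator hGm).mul (((hdm.add hdsm).sub measurable_const).const_mul _)
    have hlhs_i : Integrable (fun ω => Good.indicator (1 : BondConfig V → ℝ) ω * (2 * ρ * (d ω + ds ω - 1))) μ := by
      refine Integrable.of_bound hlhs_m.aestronglyMeasurable (1 * (2 * |ρ| * 1)) (ae_of_all _ fun ω => ?_)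
      rw [Real.norm_eq_abs, abs_mul]
      refine mul_le_mul (hind1 Good ω) ?_ (abs_nonneg _) zero_le_one
      rw [abs_mul, abs_mul, abs_two]
      refine mul_le_mul_of_nonneg_left ?_ (by positivity)
      have h1 := blockDockingSum_mem_Icc G p B F ω
      have h2 := blockDockingSum_mem_Icc G p B Fs ω
      rw [← hd] at h1
      rw [← hds] at h2
      rw [abs_le]
      exact ⟨by linarith [h1.1, h2.1], by linarith [h1.2, h2.2]⟩
    refine integral_mono hlhs_i hrhs_i fun ω => ?_
    -- pointwise: trivial off `Good`, the docking bound on `Good`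
    by_cases hG : ω ∈ Good
    · have hobs : ∀ ξ ∈ B.powerset, μ.real {ζ | obs ζ B = ξ} *
          (X (ω \ ↑B ∪ ↑ξ) * φ (obs (ω \ ↑B ∪ ↑ξ) B)) =
          μ.real {ζ | obs ζ B = ξ} * (X (ω \ ↑B ∪ ↑ξ) * φ ξ) := fun ξ hξ => by
        rw [obs_sdiff_union (Finset.mem_powerset.1 hξ)]
      have hdk := le_sum_powerset_mul_bit_of_dockings G p B ω hX1 O D (F ω) (Fs ω) hO hD (hF ω)
        (hFs ω) hOD (hFO ω hG) (hFD ω hG)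
      show Good.indicator (1 : BondConfig V → ℝ) ω * (2 * ρ * (d ω + ds ω - 1)) ≤
        Good.indicator (1 : BondConfig V → ℝ) ω * S ω
      rw [Set.indicator_of_mem hG, Pi.one_apply, one_mul, one_mul, hS]
      dsimp only
      rw [Finset.sum_congr rfl hobs, hd, hds, blockDockingSum_eq_real, blockDockingSum_eq_real]
      exact hdk
    · show Good.indicator (1 : BondConfig V → ℝ) ω * (2 * ρ * (d ω + ds ω - 1)) ≤
        Good.indicator (1 : BondConfig V → ℝ) ω * S ω
      rw [Set.indicator_of_notMem hG, zero_mul, zero_mul]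
  linarith

end Literature.Probability.Percolation
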